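import Summits.CriticalPhenomena.PercolationContinuityZ3.Theorems.PercNearOneGluingNoHeavyLowerTailSahiCombMixMixedCells
import Summits.CriticalPhenomena.PercolationContinuityZ3.Theorems.PercNearOneGluingNoHeavyLowerTailSahiCombMixGrow

/-!
# The comb (tensor-Bernstein) hierarchy for Sahi's `E_k`, L: MIXED steps over a triple — every common-order family of THREE monotone decision lists is
# hereditarily comb-positive

Support file of the one-cut programme (crux `NoHeavyLowerTail`, stmt-CriticalPhenomena-4575; cell `prim-masterthm`, seat P3, gen 9;
`run/shared/lean/prim/prim-masterthm/prim-masterthm-p3/HIERARCHY.md` §17).  The three mixed comb cells of `…SahiCombMixMixedCells` (`combPos_three_orAndId/orAndAnd/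
orOrAnd`), comb H-MIX(3) (`SahiCombHereditary.combHereditaryMixture_three`) and the meet step (`SahiCombHereditary.combHereditary_andCoord`) cover every pattern:
* **`combHereditary_orAndCoord_three`** — for three increasing events ignoring `e` with `CombHereditary U` and ANY selectors `G₁` (OR) and `G₂` (AND), the mixed
  family `orAndCoord U e G₁ G₂` is `CombHereditary` (64 selector cases reduced to 1 + 7 + 7 + 12 patterns; mixed patterns by re-indexing the canonical cells with
  `CombHereditary.of_eq_biInter`).
* `grow₂ U L` — apply a list of mixed steps `(e, G₁, G₂)` (innermost = last) to a start family; **`combHereditary_grow₂_three`** — any CombHereditary increasing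
  triple determined by `S`, grown by mixed steps on pairwise distinct coordinates outside `S`, stays `CombHereditary`; **`combHereditary_decisionList_three`** — from a
  constant start: EVERY triple of monotone read-once DECISION LISTS over a common coordinate order (member `j` at coordinate `e`: "accept if `e ∈ ω`" / "reject if
  `e ∉ ω`" / skip) is comb-positive at every order; `sahiE_three_decisionList_nonneg` (E_3 ≥ 0 under every product measure).
PLACE: for triples the one-coordinate induction is now complete for all three step types at once (OR, AND, mixed); such triples generally have coordinates essential
to all three members, so they are not covered by the class-T theorem of seat P2.  Four members: the pure steps are theorems (…Caterpillar/…Grow); the mixed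
four-member cells are censused (kit, this gen) but not proved.  HONEST FRAMING: nothing here asserts (M⁺-k) or `C_k` for `k ≥ 3` in general. [this work]
-/

noncomputable section

open scoped Classical

namespace Summit.CriticalPhenomena.PercolationContinuityZ3.Theorems

open Finset Function
open Literature.Combinatorics.Sahi2008
open Literature.Probability.Percolation (DeterminedBy determinedBy_iff determinedBy_univ)
open Literature.Probability.Percolation.DecisionTree (ind ind_of_mem ind_of_not_mem ind_nonneg)
open SahiComb
open SahiCombDisjunct (orCoord)
open SahiCombHereditary (CombHereditary andCoord)

variable {ι : Type} [Fintype ι]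

namespace SahiCombMix

/-! ### Monotonicity and the canonical mixed families as `CombHereditary` triples -/

omit [Fintype ι] in
/-- Members of a mixed step are increasing when the `U_j` are. [this work] -/
theorem isUpperSet_orAndCoord {n : ℕ} {U : Fin n → Set (Set ι)} (hU : ∀ j, IsUpperSet (U j)) (e : ι) (G₁ G₂ : Fin n → Bool) (j : Fin n) :
    IsUpperSet (orAndCoord U e G₁ G₂ j) := by
  unfold orAndCoord
  cases G₁ j <;> cases G₂ j
  · exact hU j
  · exact (hU j).inter fun ω ω' hle (he : e ∈ ω) => hle he
  · exact (hU j).union fun ω ω' hle (he : e ∈ ω) => hle he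
  · exact (hU j).union fun ω ω' hle (he : e ∈ ω) => hle he

section Canon

variable (U : Fin 3 → Set (Set ι)) (e : ι) (hUup : ∀ j, IsUpperSet (U j)) (hUe : ∀ (j : Fin 3) (b : Bool), secAt e b (U j) = U j)
include hUup hUe

/-- Canonical mixed triple M1 `(U_0∪[e], U_1∩[e], U_2)` is `CombHereditary`. [this work] -/
theorem combHereditary_three_orAndId (hU : CombHereditary U) :
    CombHereditary (orAndCoord U e (![true, false, false] : Fin 3 → Bool) (![false, true, false] : Fin 3 → Bool)) :=
  SahiCombHereditary.combHereditary_three_of_cubic _ (isUpperSet_orAndCoord hUup e _ _) (combPos_three_orAndId U e hUe hU)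

/-- Canonical mixed triple M2 `(U_0∪[e], U_1∩[e], U_2∩[e])` is `CombHereditary`. [this work] -/
theorem combHereditary_three_orAndAnd (hU : CombHereditary U) :
    CombHereditary (orAndCoord U e (![true, false, false] : Fin 3 → Bool) (![false, true, true] : Fin 3 → Bool)) :=
  SahiCombHereditary.combHereditary_three_of_cubic _ (isUpperSet_orAndCoord hUup e _ _) (combPos_three_orAndAnd U e hUe hU)

/-- Canonical mixed triple M3 `(U_0∪[e], U_1∪[e], U_2∩[e])` is `CombHereditary` — for ANY increasing triple ignoring `e`. [this work] -/
theorem combHereditary_three_orOrAnd :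
    CombHereditary (orAndCoord U e (![true, true, false] : Fin 3 → Bool) (![false, false, true] : Fin 3 → Bool)) :=
  SahiCombHereditary.combHereditary_three_of_cubic _ (isUpperSet_orAndCoord hUup e _ _) (combPos_three_orOrAnd U e hUe)

end Canon

/-! ### Every selector pattern -/

/-- **MIXED STEP OVER A TRIPLE.**  For three increasing events ignoring `e` with `CombHereditary U` and any OR-selector `G₁` / AND-selector `G₂`, the family
`orAndCoord U e G₁ G₂` is `CombHereditary`. [this work] -/
theorem combHereditary_orAndCoord_three (U : Fin 3 → Set (Set ι)) (e : ι) (G₁ G₂ : Fin 3 → Bool) (hUup : ∀ j, IsUpperSet (U j))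
    (hUe : ∀ (j : Fin 3) (b : Bool), secAt e b (U j) = U j) (hU : CombHereditary U) : CombHereditary (orAndCoord U e G₁ G₂) := by
  have hU3 : ∀ i j k : Fin 3, CombHereditary (![U i, U j, U k] : Fin 3 → Set (Set ι)) := fun i j k =>
    hU.of_eq_biInter ![({i} : Finset (Fin 3)), {j}, {k}] (by intro l; fin_cases l <;> simp)
  have hUe3 : ∀ (i j k : Fin 3) (l : Fin 3) (b : Bool), secAt e b ((![U i, U j, U k] : Fin 3 → Set (Set ι)) l) = (![U i, U j, U k] : Fin 3 → Set (Set ι)) l :=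
    fun i j k l b => by fin_cases l <;> exact hUe _ b
  have hUup3 : ∀ (i j k : Fin 3) (l : Fin 3), IsUpperSet ((![U i, U j, U k] : Fin 3 → Set (Set ι)) l) :=
    fun i j k l => by fin_cases l <;> exact hUup _
  cases h10 : G₁ 0 <;> cases h20 : G₂ 0 <;> cases h11 : G₁ 1 <;> cases h21 : G₂ 1 <;> cases h12 : G₁ 2 <;> cases h22 : G₂ 2
  · exact hU.of_eq_biInter (![({0} : Finset (Fin 3)), ({1} : Finset (Fin 3)), ({2} : Finset (Fin 3))] : Fin 3 → Finset (Fin 3)) (by intro l; fin_cases l <;> simp [orAndCoord, h10, h20, h11, h21, h12, h22])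
  · exact (SahiCombHereditary.combHereditary_andCoord U e (![false, false, true] : Fin 3 → Bool) hUe hU).of_eq_biInter (![({0} : Finset (Fin 3)), ({1} : Finset (Fin 3)), ({2} : Finset (Fin 3))] : Fin 3 → Finset (Fin 3)) (by intro l; fin_cases l <;> simp [orAndCoord, SahiCombHereditary.andCoord, h10, h20, h11, h21, h12, h22])
  · exact (SahiCombHereditary.combHereditaryMixture_three U e (![false, false, true] : Fin 3 → Bool) hUup hUe hU).of_eq_biInter (![({0} : Finset (Fin 3)), ({1} : Finset (Fin 3)), ({2} : Finset (Fin 3))] : Fin 3 → Finset (Fin 3)) (by intro l; fin_cases l <;> simp [orAndCoord, SahiCombDisjunct.orCoord, h10, h20, h11, h21, h12])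
  · exact (SahiCombHereditary.combHereditaryMixture_three U e (![false, false, true] : Fin 3 → Bool) hUup hUe hU).of_eq_biInter (![({0} : Finset (Fin 3)), ({1} : Finset (Fin 3)), ({2} : Finset (Fin 3))] : Fin 3 → Finset (Fin 3)) (by intro l; fin_cases l <;> simp [orAndCoord, SahiCombDisjunct.orCoord, h10, h20, h11, h21, h12])
  · exact (SahiCombHereditary.combHereditary_andCoord U e (![false, true, false] : Fin 3 → Bool) hUe hU).of_eq_biInter (![({0} : Finset (Fin 3)), ({1} : Finset (Fin 3)), ({2} : Finset (Fin 3))] : Fin 3 → Finset (Fin 3)) (by intro l; fin_cases l <;> simp [orAndCoord, SahiCombHereditary.andCoord, h10, h20, h11, h21, h12, h22])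
  · exact (SahiCombHereditary.combHereditary_andCoord U e (![false, true, true] : Fin 3 → Bool) hUe hU).of_eq_biInter (![({0} : Finset (Fin 3)), ({1} : Finset (Fin 3)), ({2} : Finset (Fin 3))] : Fin 3 → Finset (Fin 3)) (by intro l; fin_cases l <;> simp [orAndCoord, SahiCombHereditary.andCoord, h10, h20, h11, h21, h12, h22])
  · exact (combHereditary_three_orAndId (![U 2, U 1, U 0] : Fin 3 → Set (Set ι)) e (hUup3 2 1 0) (hUe3 2 1 0) (hU3 2 1 0)).of_eq_biInter (![({2} : Finset (Fin 3)), ({1} : Finset (Fin 3)), ({0} : Finset (Fin 3))] : Fin 3 → Finset (Fin 3)) (by intro l; fin_cases l <;> simp [orAndCoord, h10, h20, h11, h21, h12])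
  · exact (combHereditary_three_orAndId (![U 2, U 1, U 0] : Fin 3 → Set (Set ι)) e (hUup3 2 1 0) (hUe3 2 1 0) (hU3 2 1 0)).of_eq_biInter (![({2} : Finset (Fin 3)), ({1} : Finset (Fin 3)), ({0} : Finset (Fin 3))] : Fin 3 → Finset (Fin 3)) (by intro l; fin_cases l <;> simp [orAndCoord, h10, h20, h11, h21, h12])
  · exact (SahiCombHereditary.combHereditaryMixture_three U e (![false, true, false] : Fin 3 → Bool) hUup hUe hU).of_eq_biInter (![({0} : Finset (Fin 3)), ({1} : Finset (Fin 3)), ({2} : Finset (Fin 3))] : Fin 3 → Finset (Fin 3)) (by intro l; fin_cases l <;> simp [orAndCoord, SahiCombDisjunct.orCoord, h10, h20, h11, h12, h22])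
  · exact (combHereditary_three_orAndId (![U 1, U 2, U 0] : Fin 3 → Set (Set ι)) e (hUup3 1 2 0) (hUe3 1 2 0) (hU3 1 2 0)).of_eq_biInter (![({2} : Finset (Fin 3)), ({0} : Finset (Fin 3)), ({1} : Finset (Fin 3))] : Fin 3 → Finset (Fin 3)) (by intro l; fin_cases l <;> simp [orAndCoord, h10, h20, h11, h12, h22])
  · exact (SahiCombHereditary.combHereditaryMixture_three U e (![false, true, true] : Fin 3 → Bool) hUup hUe hU).of_eq_biInter (![({0} : Finset (Fin 3)), ({1} : Finset (Fin 3)), ({2} : Finset (Fin 3))] : Fin 3 → Finset (Fin 3)) (by intro l; fin_cases l <;> simp [orAndCoord, SahiCombDisjunct.orCoord, h10, h20, h11, h12])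
  · exact (SahiCombHereditary.combHereditaryMixture_three U e (![false, true, true] : Fin 3 → Bool) hUup hUe hU).of_eq_biInter (![({0} : Finset (Fin 3)), ({1} : Finset (Fin 3)), ({2} : Finset (Fin 3))] : Fin 3 → Finset (Fin 3)) (by intro l; fin_cases l <;> simp [orAndCoord, SahiCombDisjunct.orCoord, h10, h20, h11, h12])
  · exact (SahiCombHereditary.combHereditaryMixture_three U e (![false, true, false] : Fin 3 → Bool) hUup hUe hU).of_eq_biInter (![({0} : Finset (Fin 3)), ({1} : Finset (Fin 3)), ({2} : Finset (Fin 3))] : Fin 3 → Finset (Fin 3)) (by intro l; fin_cases l <;> simp [orAndCoord, SahiCombDisjunct.orCoord, h10, h20, h11, h12, h22])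
  · exact (combHereditary_three_orAndId (![U 1, U 2, U 0] : Fin 3 → Set (Set ι)) e (hUup3 1 2 0) (hUe3 1 2 0) (hU3 1 2 0)).of_eq_biInter (![({2} : Finset (Fin 3)), ({0} : Finset (Fin 3)), ({1} : Finset (Fin 3))] : Fin 3 → Finset (Fin 3)) (by intro l; fin_cases l <;> simp [orAndCoord, h10, h20, h11, h12, h22])
  · exact (SahiCombHereditary.combHereditaryMixture_three U e (![false, true, true] : Fin 3 → Bool) hUup hUe hU).of_eq_biInter (![({0} : Finset (Fin 3)), ({1} : Finset (Fin 3)), ({2} : Finset (Fin 3))] : Fin 3 → Finset (Fin 3)) (by intro l; fin_cases l <;> simp [orAndCoord, SahiCombDisjunct.orCoord, h10, h20, h11, h12])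
  · exact (SahiCombHereditary.combHereditaryMixture_three U e (![false, true, true] : Fin 3 → Bool) hUup hUe hU).of_eq_biInter (![({0} : Finset (Fin 3)), ({1} : Finset (Fin 3)), ({2} : Finset (Fin 3))] : Fin 3 → Finset (Fin 3)) (by intro l; fin_cases l <;> simp [orAndCoord, SahiCombDisjunct.orCoord, h10, h20, h11, h12])
  · exact (SahiCombHereditary.combHereditary_andCoord U e (![true, false, false] : Fin 3 → Bool) hUe hU).of_eq_biInter (![({0} : Finset (Fin 3)), ({1} : Finset (Fin 3)), ({2} : Finset (Fin 3))] : Fin 3 → Finset (Fin 3)) (by intro l; fin_cases l <;> simp [orAndCoord, SahiCombHereditary.andCoord, h10, h20, h11, h21, h12, h22])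
  · exact (SahiCombHereditary.combHereditary_andCoord U e (![true, false, true] : Fin 3 → Bool) hUe hU).of_eq_biInter (![({0} : Finset (Fin 3)), ({1} : Finset (Fin 3)), ({2} : Finset (Fin 3))] : Fin 3 → Finset (Fin 3)) (by intro l; fin_cases l <;> simp [orAndCoord, SahiCombHereditary.andCoord, h10, h20, h11, h21, h12, h22])
  · exact (combHereditary_three_orAndId (![U 2, U 0, U 1] : Fin 3 → Set (Set ι)) e (hUup3 2 0 1) (hUe3 2 0 1) (hU3 2 0 1)).of_eq_biInter (![({1} : Finset (Fin 3)), ({2} : Finset (Fin 3)), ({0} : Finset (Fin 3))] : Fin 3 → Finset (Fin 3)) (by intro l; fin_cases l <;> simp [orAndCoord, h10, h20, h11, h21, h12])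
  · exact (combHereditary_three_orAndId (![U 2, U 0, U 1] : Fin 3 → Set (Set ι)) e (hUup3 2 0 1) (hUe3 2 0 1) (hU3 2 0 1)).of_eq_biInter (![({1} : Finset (Fin 3)), ({2} : Finset (Fin 3)), ({0} : Finset (Fin 3))] : Fin 3 → Finset (Fin 3)) (by intro l; fin_cases l <;> simp [orAndCoord, h10, h20, h11, h21, h12])
  · exact (SahiCombHereditary.combHereditary_andCoord U e (![true, true, false] : Fin 3 → Bool) hUe hU).of_eq_biInter (![({0} : Finset (Fin 3)), ({1} : Finset (Fin 3)), ({2} : Finset (Fin 3))] : Fin 3 → Finset (Fin 3)) (by intro l; fin_cases l <;> simp [orAndCoord, SahiCombHereditary.andCoord, h10, h20, h11, h21, h12, h22])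
  · exact (SahiCombHereditary.combHereditary_andCoord U e (![true, true, true] : Fin 3 → Bool) hUe hU).of_eq_biInter (![({0} : Finset (Fin 3)), ({1} : Finset (Fin 3)), ({2} : Finset (Fin 3))] : Fin 3 → Finset (Fin 3)) (by intro l; fin_cases l <;> simp [orAndCoord, SahiCombHereditary.andCoord, h10, h20, h11, h21, h12, h22])
  · exact (combHereditary_three_orAndAnd (![U 2, U 0, U 1] : Fin 3 → Set (Set ι)) e (hUup3 2 0 1) (hUe3 2 0 1) (hU3 2 0 1)).of_eq_biInter (![({1} : Finset (Fin 3)), ({2} : Finset (Fin 3)), ({0} : Finset (Fin 3))] : Fin 3 → Finset (Fin 3)) (by intro l; fin_cases l <;> simp [orAndCoord, h10, h20, h11, h21, h12])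
  · exact (combHereditary_three_orAndAnd (![U 2, U 0, U 1] : Fin 3 → Set (Set ι)) e (hUup3 2 0 1) (hUe3 2 0 1) (hU3 2 0 1)).of_eq_biInter (![({1} : Finset (Fin 3)), ({2} : Finset (Fin 3)), ({0} : Finset (Fin 3))] : Fin 3 → Finset (Fin 3)) (by intro l; fin_cases l <;> simp [orAndCoord, h10, h20, h11, h21, h12])
  · exact (combHereditary_three_orAndId (![U 1, U 0, U 2] : Fin 3 → Set (Set ι)) e (hUup3 1 0 2) (hUe3 1 0 2) (hU3 1 0 2)).of_eq_biInter (![({1} : Finset (Fin 3)), ({0} : Finset (Fin 3)), ({2} : Finset (Fin 3))] : Fin 3 → Finset (Fin 3)) (by intro l; fin_cases l <;> simp [orAndCoord, h10, h20, h11, h12, h22])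
  · exact (combHereditary_three_orAndAnd (![U 1, U 0, U 2] : Fin 3 → Set (Set ι)) e (hUup3 1 0 2) (hUe3 1 0 2) (hU3 1 0 2)).of_eq_biInter (![({1} : Finset (Fin 3)), ({0} : Finset (Fin 3)), ({2} : Finset (Fin 3))] : Fin 3 → Finset (Fin 3)) (by intro l; fin_cases l <;> simp [orAndCoord, h10, h20, h11, h12, h22])
  · exact (combHereditary_three_orOrAnd (![U 1, U 2, U 0] : Fin 3 → Set (Set ι)) e (hUup3 1 2 0) (hUe3 1 2 0)).of_eq_biInter (![({2} : Finset (Fin 3)), ({0} : Finset (Fin 3)), ({1} : Finset (Fin 3))] : Fin 3 → Finset (Fin 3)) (by intro l; fin_cases l <;> simp [orAndCoord, h10, h20, h11, h12])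
  · exact (combHereditary_three_orOrAnd (![U 1, U 2, U 0] : Fin 3 → Set (Set ι)) e (hUup3 1 2 0) (hUe3 1 2 0)).of_eq_biInter (![({2} : Finset (Fin 3)), ({0} : Finset (Fin 3)), ({1} : Finset (Fin 3))] : Fin 3 → Finset (Fin 3)) (by intro l; fin_cases l <;> simp [orAndCoord, h10, h20, h11, h12])
  · exact (combHereditary_three_orAndId (![U 1, U 0, U 2] : Fin 3 → Set (Set ι)) e (hUup3 1 0 2) (hUe3 1 0 2) (hU3 1 0 2)).of_eq_biInter (![({1} : Finset (Fin 3)), ({0} : Finset (Fin 3)), ({2} : Finset (Fin 3))] : Fin 3 → Finset (Fin 3)) (by intro l; fin_cases l <;> simp [orAndCoord, h10, h20, h11, h12, h22])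
  · exact (combHereditary_three_orAndAnd (![U 1, U 0, U 2] : Fin 3 → Set (Set ι)) e (hUup3 1 0 2) (hUe3 1 0 2) (hU3 1 0 2)).of_eq_biInter (![({1} : Finset (Fin 3)), ({0} : Finset (Fin 3)), ({2} : Finset (Fin 3))] : Fin 3 → Finset (Fin 3)) (by intro l; fin_cases l <;> simp [orAndCoord, h10, h20, h11, h12, h22])
  · exact (combHereditary_three_orOrAnd (![U 1, U 2, U 0] : Fin 3 → Set (Set ι)) e (hUup3 1 2 0) (hUe3 1 2 0)).of_eq_biInter (![({2} : Finset (Fin 3)), ({0} : Finset (Fin 3)), ({1} : Finset (Fin 3))] : Fin 3 → Finset (Fin 3)) (by intro l; fin_cases l <;> simp [orAndCoord, h10, h20, h11, h12])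
  · exact (combHereditary_three_orOrAnd (![U 1, U 2, U 0] : Fin 3 → Set (Set ι)) e (hUup3 1 2 0) (hUe3 1 2 0)).of_eq_biInter (![({2} : Finset (Fin 3)), ({0} : Finset (Fin 3)), ({1} : Finset (Fin 3))] : Fin 3 → Finset (Fin 3)) (by intro l; fin_cases l <;> simp [orAndCoord, h10, h20, h11, h12])
  · exact (SahiCombHereditary.combHereditaryMixture_three U e (![true, false, false] : Fin 3 → Bool) hUup hUe hU).of_eq_biInter (![({0} : Finset (Fin 3)), ({1} : Finset (Fin 3)), ({2} : Finset (Fin 3))] : Fin 3 → Finset (Fin 3)) (by intro l; fin_cases l <;> simp [orAndCoord, SahiCombDisjunct.orCoord, h10, h11, h21, h12, h22])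
  · exact (combHereditary_three_orAndId (![U 0, U 2, U 1] : Fin 3 → Set (Set ι)) e (hUup3 0 2 1) (hUe3 0 2 1) (hU3 0 2 1)).of_eq_biInter (![({0} : Finset (Fin 3)), ({2} : Finset (Fin 3)), ({1} : Finset (Fin 3))] : Fin 3 → Finset (Fin 3)) (by intro l; fin_cases l <;> simp [orAndCoord, h10, h11, h21, h12, h22])
  · exact (SahiCombHereditary.combHereditaryMixture_three U e (![true, false, true] : Fin 3 → Bool) hUup hUe hU).of_eq_biInter (![({0} : Finset (Fin 3)), ({1} : Finset (Fin 3)), ({2} : Finset (Fin 3))] : Fin 3 → Finset (Fin 3)) (by intro l; fin_cases l <;> simp [orAndCoord, SahiCombDisjunct.orCoord, h10, h11, h21, h12])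
  · exact (SahiCombHereditary.combHereditaryMixture_three U e (![true, false, true] : Fin 3 → Bool) hUup hUe hU).of_eq_biInter (![({0} : Finset (Fin 3)), ({1} : Finset (Fin 3)), ({2} : Finset (Fin 3))] : Fin 3 → Finset (Fin 3)) (by intro l; fin_cases l <;> simp [orAndCoord, SahiCombDisjunct.orCoord, h10, h11, h21, h12])
  · exact (combHereditary_three_orAndId (![U 0, U 1, U 2] : Fin 3 → Set (Set ι)) e (hUup3 0 1 2) (hUe3 0 1 2) (hU3 0 1 2)).of_eq_biInter (![({0} : Finset (Fin 3)), ({1} : Finset (Fin 3)), ({2} : Finset (Fin 3))] : Fin 3 → Finset (Fin 3)) (by intro l; fin_cases l <;> simp [orAndCoord, h10, h11, h21, h12, h22])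
  · exact (combHereditary_three_orAndAnd (![U 0, U 1, U 2] : Fin 3 → Set (Set ι)) e (hUup3 0 1 2) (hUe3 0 1 2) (hU3 0 1 2)).of_eq_biInter (![({0} : Finset (Fin 3)), ({1} : Finset (Fin 3)), ({2} : Finset (Fin 3))] : Fin 3 → Finset (Fin 3)) (by intro l; fin_cases l <;> simp [orAndCoord, h10, h11, h21, h12, h22])
  · exact (combHereditary_three_orOrAnd (![U 0, U 2, U 1] : Fin 3 → Set (Set ι)) e (hUup3 0 2 1) (hUe3 0 2 1)).of_eq_biInter (![({0} : Finset (Fin 3)), ({2} : Finset (Fin 3)), ({1} : Finset (Fin 3))] : Fin 3 → Finset (Fin 3)) (by intro l; fin_cases l <;> simp [orAndCoord, h10, h11, h21, h12])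
  · exact (combHereditary_three_orOrAnd (![U 0, U 2, U 1] : Fin 3 → Set (Set ι)) e (hUup3 0 2 1) (hUe3 0 2 1)).of_eq_biInter (![({0} : Finset (Fin 3)), ({2} : Finset (Fin 3)), ({1} : Finset (Fin 3))] : Fin 3 → Finset (Fin 3)) (by intro l; fin_cases l <;> simp [orAndCoord, h10, h11, h21, h12])
  · exact (SahiCombHereditary.combHereditaryMixture_three U e (![true, true, false] : Fin 3 → Bool) hUup hUe hU).of_eq_biInter (![({0} : Finset (Fin 3)), ({1} : Finset (Fin 3)), ({2} : Finset (Fin 3))] : Fin 3 → Finset (Fin 3)) (by intro l; fin_cases l <;> simp [orAndCoord, SahiCombDisjunct.orCoord, h10, h11, h12, h22])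
  · exact (combHereditary_three_orOrAnd (![U 0, U 1, U 2] : Fin 3 → Set (Set ι)) e (hUup3 0 1 2) (hUe3 0 1 2)).of_eq_biInter (![({0} : Finset (Fin 3)), ({1} : Finset (Fin 3)), ({2} : Finset (Fin 3))] : Fin 3 → Finset (Fin 3)) (by intro l; fin_cases l <;> simp [orAndCoord, h10, h11, h12, h22])
  · exact (SahiCombHereditary.combHereditaryMixture_three U e (![true, true, true] : Fin 3 → Bool) hUup hUe hU).of_eq_biInter (![({0} : Finset (Fin 3)), ({1} : Finset (Fin 3)), ({2} : Finset (Fin 3))] : Fin 3 → Finset (Fin 3)) (by intro l; fin_cases l <;> simp [orAndCoord, SahiCombDisjunct.orCoord, h10, h11, h12])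
  · exact (SahiCombHereditary.combHereditaryMixture_three U e (![true, true, true] : Fin 3 → Bool) hUup hUe hU).of_eq_biInter (![({0} : Finset (Fin 3)), ({1} : Finset (Fin 3)), ({2} : Finset (Fin 3))] : Fin 3 → Finset (Fin 3)) (by intro l; fin_cases l <;> simp [orAndCoord, SahiCombDisjunct.orCoord, h10, h11, h12])
  · exact (SahiCombHereditary.combHereditaryMixture_three U e (![true, true, false] : Fin 3 → Bool) hUup hUe hU).of_eq_biInter (![({0} : Finset (Fin 3)), ({1} : Finset (Fin 3)), ({2} : Finset (Fin 3))] : Fin 3 → Finset (Fin 3)) (by intro l; fin_cases l <;> simp [orAndCoord, SahiCombDisjunct.orCoord, h10, h11, h12, h22])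
  · exact (combHereditary_three_orOrAnd (![U 0, U 1, U 2] : Fin 3 → Set (Set ι)) e (hUup3 0 1 2) (hUe3 0 1 2)).of_eq_biInter (![({0} : Finset (Fin 3)), ({1} : Finset (Fin 3)), ({2} : Finset (Fin 3))] : Fin 3 → Finset (Fin 3)) (by intro l; fin_cases l <;> simp [orAndCoord, h10, h11, h12, h22])
  · exact (SahiCombHereditary.combHereditaryMixture_three U e (![true, true, true] : Fin 3 → Bool) hUup hUe hU).of_eq_biInter (![({0} : Finset (Fin 3)), ({1} : Finset (Fin 3)), ({2} : Finset (Fin 3))] : Fin 3 → Finset (Fin 3)) (by intro l; fin_cases l <;> simp [orAndCoord, SahiCombDisjunct.orCoord, h10, h11, h12])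
  · exact (SahiCombHereditary.combHereditaryMixture_three U e (![true, true, true] : Fin 3 → Bool) hUup hUe hU).of_eq_biInter (![({0} : Finset (Fin 3)), ({1} : Finset (Fin 3)), ({2} : Finset (Fin 3))] : Fin 3 → Finset (Fin 3)) (by intro l; fin_cases l <;> simp [orAndCoord, SahiCombDisjunct.orCoord, h10, h11, h12])
  · exact (SahiCombHereditary.combHereditaryMixture_three U e (![true, false, false] : Fin 3 → Bool) hUup hUe hU).of_eq_biInter (![({0} : Finset (Fin 3)), ({1} : Finset (Fin 3)), ({2} : Finset (Fin 3))] : Fin 3 → Finset (Fin 3)) (by intro l; fin_cases l <;> simp [orAndCoord, SahiCombDisjunct.orCoord, h10, h11, h21, h12, h22])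
  · exact (combHereditary_three_orAndId (![U 0, U 2, U 1] : Fin 3 → Set (Set ι)) e (hUup3 0 2 1) (hUe3 0 2 1) (hU3 0 2 1)).of_eq_biInter (![({0} : Finset (Fin 3)), ({2} : Finset (Fin 3)), ({1} : Finset (Fin 3))] : Fin 3 → Finset (Fin 3)) (by intro l; fin_cases l <;> simp [orAndCoord, h10, h11, h21, h12, h22])
  · exact (SahiCombHereditary.combHereditaryMixture_three U e (![true, false, true] : Fin 3 → Bool) hUup hUe hU).of_eq_biInter (![({0} : Finset (Fin 3)), ({1} : Finset (Fin 3)), ({2} : Finset (Fin 3))] : Fin 3 → Finset (Fin 3)) (by intro l; fin_cases l <;> simp [orAndCoord, SahiCombDisjunct.orCoord, h10, h11, h21, h12])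
  · exact (SahiCombHereditary.combHereditaryMixture_three U e (![true, false, true] : Fin 3 → Bool) hUup hUe hU).of_eq_biInter (![({0} : Finset (Fin 3)), ({1} : Finset (Fin 3)), ({2} : Finset (Fin 3))] : Fin 3 → Finset (Fin 3)) (by intro l; fin_cases l <;> simp [orAndCoord, SahiCombDisjunct.orCoord, h10, h11, h21, h12])
  · exact (combHereditary_three_orAndId (![U 0, U 1, U 2] : Fin 3 → Set (Set ι)) e (hUup3 0 1 2) (hUe3 0 1 2) (hU3 0 1 2)).of_eq_biInter (![({0} : Finset (Fin 3)), ({1} : Finset (Fin 3)), ({2} : Finset (Fin 3))] : Fin 3 → Finset (Fin 3)) (by intro l; fin_cases l <;> simp [orAndCoord, h10, h11, h21, h12, h22])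
  · exact (combHereditary_three_orAndAnd (![U 0, U 1, U 2] : Fin 3 → Set (Set ι)) e (hUup3 0 1 2) (hUe3 0 1 2) (hU3 0 1 2)).of_eq_biInter (![({0} : Finset (Fin 3)), ({1} : Finset (Fin 3)), ({2} : Finset (Fin 3))] : Fin 3 → Finset (Fin 3)) (by intro l; fin_cases l <;> simp [orAndCoord, h10, h11, h21, h12, h22])
  · exact (combHereditary_three_orOrAnd (![U 0, U 2, U 1] : Fin 3 → Set (Set ι)) e (hUup3 0 2 1) (hUe3 0 2 1)).of_eq_biInter (![({0} : Finset (Fin 3)), ({2} : Finset (Fin 3)), ({1} : Finset (Fin 3))] : Fin 3 → Finset (Fin 3)) (by intro l; fin_cases l <;> simp [orAndCoord, h10, h11, h21, h12])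
  · exact (combHereditary_three_orOrAnd (![U 0, U 2, U 1] : Fin 3 → Set (Set ι)) e (hUup3 0 2 1) (hUe3 0 2 1)).of_eq_biInter (![({0} : Finset (Fin 3)), ({2} : Finset (Fin 3)), ({1} : Finset (Fin 3))] : Fin 3 → Finset (Fin 3)) (by intro l; fin_cases l <;> simp [orAndCoord, h10, h11, h21, h12])
  · exact (SahiCombHereditary.combHereditaryMixture_three U e (![true, true, false] : Fin 3 → Bool) hUup hUe hU).of_eq_biInter (![({0} : Finset (Fin 3)), ({1} : Finset (Fin 3)), ({2} : Finset (Fin 3))] : Fin 3 → Finset (Fin 3)) (by intro l; fin_cases l <;> simp [orAndCoord, SahiCombDisjunct.orCoord, h10, h11, h12, h22])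
  · exact (combHereditary_three_orOrAnd (![U 0, U 1, U 2] : Fin 3 → Set (Set ι)) e (hUup3 0 1 2) (hUe3 0 1 2)).of_eq_biInter (![({0} : Finset (Fin 3)), ({1} : Finset (Fin 3)), ({2} : Finset (Fin 3))] : Fin 3 → Finset (Fin 3)) (by intro l; fin_cases l <;> simp [orAndCoord, h10, h11, h12, h22])
  · exact (SahiCombHereditary.combHereditaryMixture_three U e (![true, true, true] : Fin 3 → Bool) hUup hUe hU).of_eq_biInter (![({0} : Finset (Fin 3)), ({1} : Finset (Fin 3)), ({2} : Finset (Fin 3))] : Fin 3 → Finset (Fin 3)) (by intro l; fin_cases l <;> simp [orAndCoord, SahiCombDisjunct.orCoord, h10, h11, h12])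
  · exact (SahiCombHereditary.combHereditaryMixture_three U e (![true, true, true] : Fin 3 → Bool) hUup hUe hU).of_eq_biInter (![({0} : Finset (Fin 3)), ({1} : Finset (Fin 3)), ({2} : Finset (Fin 3))] : Fin 3 → Finset (Fin 3)) (by intro l; fin_cases l <;> simp [orAndCoord, SahiCombDisjunct.orCoord, h10, h11, h12])
  · exact (SahiCombHereditary.combHereditaryMixture_three U e (![true, true, false] : Fin 3 → Bool) hUup hUe hU).of_eq_biInter (![({0} : Finset (Fin 3)), ({1} : Finset (Fin 3)), ({2} : Finset (Fin 3))] : Fin 3 → Finset (Fin 3)) (by intro l; fin_cases l <;> simp [orAndCoord, SahiCombDisjunct.orCoord, h10, h11, h12, h22])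
  · exact (combHereditary_three_orOrAnd (![U 0, U 1, U 2] : Fin 3 → Set (Set ι)) e (hUup3 0 1 2) (hUe3 0 1 2)).of_eq_biInter (![({0} : Finset (Fin 3)), ({1} : Finset (Fin 3)), ({2} : Finset (Fin 3))] : Fin 3 → Finset (Fin 3)) (by intro l; fin_cases l <;> simp [orAndCoord, h10, h11, h12, h22])
  · exact (SahiCombHereditary.combHereditaryMixture_three U e (![true, true, true] : Fin 3 → Bool) hUup hUe hU).of_eq_biInter (![({0} : Finset (Fin 3)), ({1} : Finset (Fin 3)), ({2} : Finset (Fin 3))] : Fin 3 → Finset (Fin 3)) (by intro l; fin_cases l <;> simp [orAndCoord, SahiCombDisjunct.orCoord, h10, h11, h12])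
  · exact (SahiCombHereditary.combHereditaryMixture_three U e (![true, true, true] : Fin 3 → Bool) hUup hUe hU).of_eq_biInter (![({0} : Finset (Fin 3)), ({1} : Finset (Fin 3)), ({2} : Finset (Fin 3))] : Fin 3 → Finset (Fin 3)) (by intro l; fin_cases l <;> simp [orAndCoord, SahiCombDisjunct.orCoord, h10, h11, h12])

/-! ### Growing by mixed steps; decision-list triples -/

/-- Apply a list of mixed steps `(e, G₁, G₂)` (innermost = last element first) to a start family. [this work] -/
def grow₂ {n : ℕ} (U : Fin n → Set (Set ι)) : List (ι × (Fin n → Bool) × (Fin n → Bool)) → Fin n → Set (Set ι)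
  | [] => U
  | s :: L => orAndCoord (grow₂ U L) s.1 s.2.1 s.2.2

omit [Fintype ι] in
/-- Grown members are increasing if the start is. [this work] -/
theorem isUpperSet_grow₂ {n : ℕ} {U : Fin n → Set (Set ι)} (hU : ∀ j, IsUpperSet (U j)) :
    ∀ (L : List (ι × (Fin n → Bool) × (Fin n → Bool))) (j : Fin n), IsUpperSet (grow₂ U L j)
  | [], j => hU j
  | s :: L, j => isUpperSet_orAndCoord (isUpperSet_grow₂ hU L) s.1 s.2.1 s.2.2 j

omit [Fintype ι] in
/-- A mixed step at `e` keeps events determined by a set containing `e` so determined. [folklore] -/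
theorem determinedBy_orAndCoord {n : ℕ} {V : Fin n → Set (Set ι)} {S : Set ι} {e : ι} (hV : ∀ j, DeterminedBy (V j) S) (he : e ∈ S)
    (G₁ G₂ : Fin n → Bool) (j : Fin n) : DeterminedBy (orAndCoord V e G₁ G₂ j) S := by
  unfold orAndCoord
  cases G₁ j
  · simpa using SahiCombHereditary.determinedBy_mix_coord (hV j) he false (G₂ j)
  · simpa using SahiCombHereditary.determinedBy_mix_coord (hV j) he true true

omit [Fintype ι] in
/-- Grown members are determined by the start's coordinates and the coordinates read. [this work] -/
theorem determinedBy_grow₂ {n : ℕ} {U : Fin n → Set (Set ι)} {S : Set ι} (hU : ∀ j, DeterminedBy (U j) S) :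
    ∀ (L : List (ι × (Fin n → Bool) × (Fin n → Bool))) (j : Fin n), DeterminedBy (grow₂ U L j) (S ∪ {x | x ∈ L.map Prod.fst})
  | [], j => (hU j).mono Set.subset_union_left
  | s :: L, j => by
    have ih : ∀ j, DeterminedBy (grow₂ U L j) (S ∪ {x | x ∈ (s :: L).map Prod.fst}) := fun j =>
      (determinedBy_grow₂ hU L j).mono fun x hx => by
        simp only [List.map_cons, List.mem_cons, Set.mem_union, Set.mem_setOf_eq] at hx ⊢
        rcases hx with hx | hx
        · exact Or.inl hx
        · exact Or.inr (Or.inr hx)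
    have hs : s.1 ∈ S ∪ {x | x ∈ (s :: L).map Prod.fst} := by simp
    exact determinedBy_orAndCoord ih hs s.2.1 s.2.2 j

/-- **GROWING A TRIPLE BY MIXED STEPS.**  Three increasing events determined by `S` with `CombHereditary U`, grown by any list of mixed steps reading pairwise
distinct coordinates outside `S`, stay `CombHereditary`. [this work] -/
theorem combHereditary_grow₂_three {U : Fin 3 → Set (Set ι)} (hUup : ∀ j, IsUpperSet (U j)) {S : Set ι} (hUS : ∀ j, DeterminedBy (U j) S)
    (hU : CombHereditary U) :
    ∀ (L : List (ι × (Fin 3 → Bool) × (Fin 3 → Bool))), (L.map Prod.fst).Nodup → (∀ s ∈ L, s.1 ∉ S) → CombHereditary (grow₂ U L)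
  | [], _, _ => hU
  | s :: L, hL, hS => by
    rw [List.map_cons, List.nodup_cons] at hL
    have ih := combHereditary_grow₂_three hUup hUS hU L hL.2 fun t ht => hS t (List.mem_cons_of_mem s ht)
    have hup := isUpperSet_grow₂ hUup L
    have hig : ∀ (j : Fin 3) (b : Bool), secAt s.1 b (grow₂ U L j) = grow₂ U L j := fun j b =>
      SahiCombJunta.secAt_eq_self_of_determinedBy (determinedBy_grow₂ hUS L j) (by
        simp only [Set.mem_union, Set.mem_setOf_eq, not_or]
        exact ⟨hS s List.mem_cons_self, hL.1⟩) b
    exact combHereditary_orAndCoord_three _ s.1 s.2.1 s.2.2 hup hig ih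

/-- **EVERY TRIPLE OF COMMON-ORDER MONOTONE DECISION LISTS IS HEREDITARILY COMB-POSITIVE.**  From a constant start (member `j` is `Ω` if `c j`, else `∅`), any list
of mixed steps with pairwise distinct coordinates produces a `CombHereditary` triple. [this work] -/
theorem combHereditary_decisionList_three (c : Fin 3 → Bool) (L : List (ι × (Fin 3 → Bool) × (Fin 3 → Bool))) (hL : (L.map Prod.fst).Nodup) :
    CombHereditary (grow₂ (fun j => bif c j then (Set.univ : Set (Set ι)) else ∅) L) := by
  refine combHereditary_grow₂_three (S := (∅ : Set ι)) (fun j => ?_) (fun j => ?_) (SahiCombHereditary.combHereditary_constFamily c) L hL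
    (fun s _ => Set.notMem_empty _)
  · cases c j
    · exact isUpperSet_empty
    · exact isUpperSet_univ
  · cases c j
    · rw [determinedBy_iff]; intro ω ω' _; simp
    · exact determinedBy_univ _

/-- Law-level shadow: `E_3 ≥ 0` (indeed every row of the ∩-closed family) for every such triple under every product measure. [this work] -/
theorem sahiE_three_decisionList_nonneg (c : Fin 3 → Bool) (L : List (ι × (Fin 3 → Bool) × (Fin 3 → Bool))) (hL : (L.map Prod.fst).Nodup)
    (p : ι → unitInterval) :
    0 ≤ sahiE (bernoulliWeight p) 3 (fun j => ind (grow₂ (fun j => bif c j then (Set.univ : Set (Set ι)) else ∅) L j)) := by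
  have h := ((combHereditary_decisionList_three c L hL).hereditaryAllOrders p) 3 (fun j => {j})
  refine le_of_le_of_eq h ?_
  congr 1; funext j
  rw [Finset.set_biInter_singleton]

end SahiCombMix

end Summit.CriticalPhenomena.PercolationContinuityZ3.Theorems

end
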